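/-
Copyright (c) 2026 the pub-hodgecm-mathlib formalisation cell (harness21).  Prover seat hodgecm-mathlib-LH4-p08 (g2), req620 Track A «(D-RAM) FOUR-FRAME» squad, unit U3_Laws (iii),
MS ROAD STAGE B (Stage B lead LH4-p10 (g2), MS ledger LH4-p11 (g0); dealer LH4-plan (g11)): brick B5 (iv) «GLUED PARAMETER BOX COUNT» of `SPEC-StageB.v2-B5split.LH4p10g2.md`
(a6778cd80cb70dec), sub-brick (iv-b-idx) «GLUED STABILISER INDEX IN THE FULL UNIT TORUS» — the full-torus twin of F0P3-p01 (g31)'s B5 (iii) Θ-engine (`F0P3cDyRamDiagonalGluedStabiliserIndex`,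
fixed torus), adapted with their leave (bus 2026-09-03T23:59:11Z).  2026-09-04.
-/
import Summits.HodgeConjecture.HodgeConjecture.Theorems.F0P3cDyRamDiagonalGluedStabiliserIndex    -- ★ (F0P3-p01 (g31)) B5 (iii) FILE 2 (brings FILE 1 `…GluedFixedStabiliser`: `mem_latticeStabilizer_latt_glued_exp_iff`, `glued_corner_iff`, `glued_first_of_corner`, `v_one_add_mul_one_sub_eq_one`, `v_defect_le`, `exists_unitLevel_subgroup`; FILE 2: `ne_zero_and_v_lt_one_of_v_eq_exp`, `v_div_sub_one_eq`)
import Literature.NumberTheory.LocalFields.RamifiedQuadraticResidueCountsUnits                       -- ★ p855694 B1 FILE 2 (F0P3-p01 (g30)): (C3) `relIndex_unitLevel_eq` (`[U : U_n] = (q−1)q^{n−1}`)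
import Summits.HodgeConjecture.HodgeConjecture.Theorems.F0P3cDyRamDiagonalUnitTorusOrbit          -- ★ p855595 (O1) §1 `ncard_unitTorus_orbit_eq_relIndex`
import Mathlib.GroupTheory.QuotientGroup.Basic
import HarnessLib

/-!
# Crux `H413`, line LH4 «(D-RAM) FOUR-FRAME» road — unit U3_Laws (iii), MS ROAD STAGE B, brick B5 (iv), sub-brick (iv-b-idx): the INDEX of the unit diagonal stabiliser of a
# GLUED lattice in the FULL unit torus, `[𝒯 : S̃(latt V)] = (q − 1)q^{ρ+s−1} · (q − 1)q^{2ρ−1}` (`V = [[1,0,0],[x,ϖ^ρ,0],[xζ+y″, ϖ^ρ ζ, ϖ^{2ρ+s}]]`, `x, ζ` units, `|y″| = |ϖ|^s`)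

Cell `hodgecm-mathlib` (D-0151), FLOOR 0, crux item H413 = `stmt-HodgeConjecture-24833`, route of record `HCCMUnconditional`; squad F0∕P3c∕LH4 (req620).  THEOREMS ONLY (no `def`,
no instance, no notation, no `sorry`, default heartbeats); lane `--supports stmt-HodgeConjecture-24833 --as helper` (count-neutral).  Fourth sub-brick of B5 (iv) (LH4-p10 (g2) SPEC
v2-B5split §B5(iv)) on the ORBIT–STABILISER route of LH4-p08 (g2): the orbit size `#(𝒯·latt V) = [𝒯 : S̃(latt V)]` (★ (O1) `ncard_unitTorus_orbit_eq_relIndex`) for a glued `V`.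
This is the FULL-torus twin of ★ F0P3-p01 (g31)'s B5 (iii) engine (`F0P3cDyRamDiagonalGluedStabiliserIndex`, `σ`-fixed torus, lineariser from (R), ★ B1 (C4)); here NO `σ`, the
lineariser is `g := xζ∕y″` itself, and the counts come from ★ B1 (C3).  The two-step structure, the twisted homomorphism and the defect estimate are theirs (★ FILE 1 helpers
`v_one_add_mul_one_sub_eq_one`, `v_defect_le`, `glued_corner_iff`, `exists_unitLevel_subgroup` BY NAME).

THE MATHEMATICS.  `𝒯 = unitTorus K 3`, `π(u) = u₁∕u₂`, `U = 𝒪^×` (the image `π(𝒯)`), `U_n = {|w| = 1, |w − 1| ≤ |ϖ|^n}`, `S₁ := π⁻¹(U_{ρ+s}) ∩ 𝒯`, `S̃ = latticeStabilizer(latt V) ∩ 𝒯`.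
STEP 1: `[𝒯 : S₁] = [U : U_{ρ+s}] = (q − 1)q^{ρ+s−1}` (`Subgroup.relIndex_comap`, ★ B1 (C3)).  STEP 2: on `S₁` the map `θ(u) = (u₀∕u₂)·(1 + g(1 − u₁∕u₂))⁻¹` is a homomorphism
into `K^× ∕ U_{2ρ}` (defect `(g + g²)(1−a)(1−a′) ∈ 𝔭^{2ρ}`), with kernel `S̃` (membership (b) ∧ (c′): `|g(u₂ − u₁) + (u₂ − u₀)| ≤ |ϖ|^{2ρ}`, ★ `glued_corner_iff` with the exact
lineariser `xζ − g·y″ = 0`) and image `U·U_{2ρ} ∕ U_{2ρ}` (onto by `u = (w, 1, 1)`), so `[S₁ : S̃] = [U : U_{2ρ}] = (q − 1)q^{2ρ−1}` (★ B1 (C3)).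

WHAT IS PROVED (generic valued field `K`, `Valued K ℤᵐ⁰`, `|ϖ| = exp(−1)`, `[Finite 𝓀[K]]`, `q = Nat.card 𝓀[K]`; `ρ ≥ 1`, `s : ℕ`):
* §1 `mem_map_unitTorus_iff` (`π(𝒯) = 𝒪^×`), `mem_unitStabilizer_latt_glued_lin_iff` (membership (b) ∧ (c′) for a lineariser `g`).
* §2 `relIndex_ratioLevel_unitTorus_eq` (STEP 1), `relIndex_latticeStabilizer_ratioLevel_eq` (STEP 2).
* §3 HEAD **`relIndex_latticeStabilizer_latt_glued_eq`** — `(latticeStabilizer (latt ↑V)).relIndex (unitTorus K 3) = ((q − 1)·q^(ρ + s − 1)) · ((q − 1)·q^(2ρ − 1))`, and the orbit form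
  **`ncard_unitTorus_orbit_latt_glued_eq`** — `#{diag(u)·latt V : u ∈ 𝒯}` equals the same number (★ (O1)).
HONEST LABEL.  Count-neutral; nothing printed is asserted; the census laws stay PROVER TARGETS; `HC_CM` is proved only modulo the 7 printed citations (2 remaining named inputs: hLiu418 =
`stmt-HodgeConjecture-24832`, h413 = `stmt-HodgeConjecture-24833`) until rung 0 closes.

## References
* [Kottwitz1986BaseChangeUnits] R. Kottwitz, *Base change for unit elements of Hecke algebras*, Compositio Math. 60 (1986), §1 pp. 240–241 (lattice counts via torus orbits and
  diagonal stabilisers).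
* [Serre1979] J.-P. Serre, *Local Fields*, GTM 67 (1979), Ch. IV §2 Prop. 6 (`U∕Uⁿ` filtration counts).
-/

set_option autoImplicit false

noncomputable section

namespace Summit.HodgeConjecture.HodgeConjecture.Cruxes.H413.F0P3cDyRamDiagonalGluedStabiliserIndexFull

open Matrix
open Literature.NumberTheory.Automorphic Literature.NumberTheory.Automorphic.HermitianLattice Literature.NumberTheory.Automorphic.UnitaryGroup
open Literature.NumberTheory.Automorphic.UnitaryLatticeTree
open Literature.NumberTheory.LocalFields.WildQuadraticDatum
open Summit.HodgeConjecture.HodgeConjecture.Cruxes.H413.F0P3cDyRamDiagonalTorusDefs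
open Summit.HodgeConjecture.HodgeConjecture.Cruxes.H413.F0P3cDyRamDiagonalGluedFixedStabiliser
open Summit.HodgeConjecture.HodgeConjecture.Cruxes.H413.F0P3cDyRamDiagonalGluedStabiliserIndex (ne_zero_and_v_lt_one_of_v_eq_exp v_div_sub_one_eq)
open Summit.HodgeConjecture.HodgeConjecture.Cruxes.H413.F0P3cDyRamDiagonalUnitTorusOrbit (ncard_unitTorus_orbit_eq_relIndex)
open scoped Valued WithZero Matrix MatrixGroups

variable {K : Type*} [Field K] [Valued K ℤᵐ⁰]

/-! ## §1 The image of `π` and the linearised membership -/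

/-- **`u ↦ u₁∕u₂` MAPS `𝒯 = (𝒪^×)³` ONTO THE UNITS `{|w| = 1}`** (onto: `u = (1, w, 1)`). [cite: Kottwitz1986BaseChangeUnits, §1 pp. 240–241] -/
theorem mem_map_unitTorus_iff (π : (Fin 3 → Kˣ) →* Kˣ) (hπ : ∀ u, π u = u 1 / u 2) (w : Kˣ) :
    w ∈ (unitTorus K 3).map π ↔ Valued.v (w : K) = 1 := by
  rw [Subgroup.mem_map]
  constructor
  · rintro ⟨u, hu, rfl⟩
    have hu1 := (mem_unitTorus_iff u).1 hu
    rw [hπ, Units.val_div_eq_div_val, map_div₀, hu1, hu1, div_one]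
  · intro hvw
    have h21 : (2 : Fin 3) ≠ 1 := by decide
    refine ⟨Pi.mulSingle 1 w, (mem_unitTorus_iff _).2 fun i => ?_, ?_⟩
    · by_cases hi : i = 1
      · subst hi; rw [Pi.mulSingle_eq_same]; exact hvw
      · rw [Pi.mulSingle_eq_of_ne hi, Units.val_one, map_one]
    · rw [hπ, Pi.mulSingle_eq_same, Pi.mulSingle_eq_of_ne h21, div_one]

/-- **`S̃(latt V)` ON THE GLUED FRAME ⟺ (b) ∧ (c′)** for `u ∈ 𝒯`: given a LINEARISER `g` (`|g|·|ϖ|^s ≤ 1`, `|xζ − g·y″| ≤ |ϖ|^ρ`; for the full torus `g := xζ∕y″` will do),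
`u ∈ latticeStabilizer (latt V) ⟺ |u₂−u₁| ≤ |ϖ|^{ρ+s} ∧ |g(u₂−u₁) + (u₂−u₀)| ≤ |ϖ|^{2ρ}` (★ FILE 1 `mem_latticeStabilizer_latt_glued_exp_iff` + `glued_corner_iff` + `glued_first_of_corner`).
[cite: Kottwitz1986BaseChangeUnits, §1 pp. 240–241] -/
theorem mem_unitStabilizer_latt_glued_lin_iff {ϖ : K} (hϖ0 : ϖ ≠ 0) (hϖ1 : Valued.v ϖ ≤ 1) (ρ s : ℕ) {x ζ y'' g : K}
    (hx : Valued.v x = 1) (hζ : Valued.v ζ = 1) (hy'' : Valued.v y'' = Valued.v ϖ ^ s) (hg : Valued.v g * Valued.v ϖ ^ s ≤ 1)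
    (hlin : Valued.v (x * ζ - g * y'') ≤ Valued.v ϖ ^ ρ)
    (V : GL (Fin 3) K) (hV : (V : Matrix (Fin 3) (Fin 3) K) = !![1, 0, 0; x, ϖ ^ ρ, 0; x * ζ + y'', ϖ ^ ρ * ζ, ϖ ^ (2 * ρ + s)])
    {u : Fin 3 → Kˣ} (hu : u ∈ unitTorus K 3) :
    u ∈ latticeStabilizer (latt (V : Matrix (Fin 3) (Fin 3) K)) ↔
      Valued.v ((u 2 : K) - u 1) ≤ Valued.v ϖ ^ (ρ + s) ∧ Valued.v (g * ((u 2 : K) - u 1) + ((u 2 : K) - u 0)) ≤ Valued.v ϖ ^ (2 * ρ) := by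
  have hu1 := (mem_unitTorus_iff u).1 hu
  rw [mem_latticeStabilizer_latt_glued_exp_iff hϖ0 ρ s hx hζ V hV u hu1]
  constructor
  · rintro ⟨-, hb, hc⟩
    exact ⟨hb, (glued_corner_iff hϖ0 ρ s hy'' hlin hb).1 hc⟩
  · rintro ⟨hb, hc'⟩
    have hc := (glued_corner_iff hϖ0 ρ s hy'' hlin hb).2 hc'
    refine ⟨?_, hb, hc⟩
    have ha := glued_first_of_corner hϖ1 ρ s hg hb hc'
    rwa [show ((u 2 : K) - u 0) - ((u 2 : K) - u 1) = (u 1 : K) - u 0 by ring] at ha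

/-! ## §2 The two index steps -/

/-- **STEP 1: `[𝒯 : S₁] = (q−1)·q^{n−1}`** for `S₁ = {u ∈ 𝒯 | u₁∕u₂ ∈ U_n}`, `n ≥ 1` (`relIndex_comap` along `u ↦ u₁∕u₂`, whose image is `𝒪^×`, then ★ B1 (C3) `[U : U_n]`).
[cite: Serre1979, Ch. IV §2 Prop. 6] -/
theorem relIndex_ratioLevel_unitTorus_eq {ϖ : K} (hϖ : Valued.v ϖ = WithZero.exp (-1 : ℤ)) [Finite 𝓀[K]] {n : ℕ} (hn : 1 ≤ n)
    (π : (Fin 3 → Kˣ) →* Kˣ) (hπ : ∀ u, π u = u 1 / u 2)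
    (Un : Subgroup Kˣ) (hUn : ∀ w : Kˣ, w ∈ Un ↔ Valued.v (w : K) = 1 ∧ Valued.v ((w : K) - 1) ≤ Valued.v ϖ ^ n) :
    (Un.comap π ⊓ unitTorus K 3).relIndex (unitTorus K 3) = (Nat.card 𝓀[K] - 1) * Nat.card 𝓀[K] ^ (n - 1) := by
  rw [Subgroup.inf_relIndex_right, Subgroup.relIndex_comap, ← Subgroup.inf_relIndex_right]
  refine relIndex_unitLevel_eq hϖ (U := (unitTorus K 3).map π) (Un := Un ⊓ (unitTorus K 3).map π)
    (fun w => mem_map_unitTorus_iff π hπ w) hn (fun w => ?_)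
  rw [Subgroup.mem_inf, hUn, mem_map_unitTorus_iff π hπ, v_pow_eq_exp_neg hϖ]
  tauto

/-- **STEP 2: `[S₁ : S̃(latt V)] = (q−1)·q^{2ρ−1}`** (`S₁` at level `ρ+s`): the twisted map `u ↦ (u₀∕u₂)·(1 + g(1 − u₁∕u₂))⁻¹` is a homomorphism `S₁ → K^×∕U_{2ρ}` (★ `v_defect_le`),
with kernel `S̃(latt V)` (§1, (c′)) and image `𝒪^×·U_{2ρ}∕U_{2ρ}` (onto by `u = (w,1,1)`), of cardinality `[U : U_{2ρ}] = (q−1)q^{2ρ−1}` (★ B1 (C3)).  Full-torus twin of F0P3-p01 (g31)'s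
`relIndex_fixedUnitStabilizer_ratioLevel_eq`. [cite: Kottwitz1986BaseChangeUnits, §1 pp. 240–241] [cite: Serre1979, Ch. IV §2 Prop. 6] -/
theorem relIndex_latticeStabilizer_ratioLevel_eq {ϖ : K} (hϖ : Valued.v ϖ = WithZero.exp (-1 : ℤ)) [Finite 𝓀[K]] {ρ : ℕ} (hρ : 1 ≤ ρ) (s : ℕ) {x ζ y'' g : K}
    (hx : Valued.v x = 1) (hζ : Valued.v ζ = 1) (hy'' : Valued.v y'' = Valued.v ϖ ^ s) (hg : Valued.v g * Valued.v ϖ ^ s ≤ 1)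
    (hlin : Valued.v (x * ζ - g * y'') ≤ Valued.v ϖ ^ ρ)
    (V : GL (Fin 3) K) (hV : (V : Matrix (Fin 3) (Fin 3) K) = !![1, 0, 0; x, ϖ ^ ρ, 0; x * ζ + y'', ϖ ^ ρ * ζ, ϖ ^ (2 * ρ + s)])
    (π : (Fin 3 → Kˣ) →* Kˣ) (hπ : ∀ u, π u = u 1 / u 2)
    (Uρs : Subgroup Kˣ) (hU : ∀ w : Kˣ, w ∈ Uρs ↔ Valued.v (w : K) = 1 ∧ Valued.v ((w : K) - 1) ≤ Valued.v ϖ ^ (ρ + s)) :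
    (latticeStabilizer (latt (V : Matrix (Fin 3) (Fin 3) K))).relIndex (Uρs.comap π ⊓ unitTorus K 3) =
      (Nat.card 𝓀[K] - 1) * Nat.card 𝓀[K] ^ (2 * ρ - 1) := by
  obtain ⟨hϖ0, hϖ1⟩ := ne_zero_and_v_lt_one_of_v_eq_exp hϖ
  set T := unitTorus K 3 with hT
  set S := latticeStabilizer (latt (V : Matrix (Fin 3) (Fin 3) K)) with hS
  set S₁ := Uρs.comap π ⊓ T with hS₁
  -- the level-`2ρ` subgroup of `K^×`
  obtain ⟨U2, hU2⟩ := exists_unitLevel_subgroup (K := K) (Valued.v ϖ ^ (2 * ρ))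
  -- membership in `S₁`, read in `K`
  have mem_S₁ : ∀ u : Fin 3 → Kˣ, u ∈ S₁ ↔
      (Valued.v ((u 1 : K) / (u 2 : K)) = 1 ∧ Valued.v ((u 1 : K) / (u 2 : K) - 1) ≤ Valued.v ϖ ^ (ρ + s)) ∧ (∀ i, Valued.v (u i : K) = 1) := by
    intro u
    rw [hS₁, Subgroup.mem_inf, Subgroup.mem_comap, hU, hπ, Units.val_div_eq_div_val, hT, mem_unitTorus_iff]
  -- the twisted ratio `θ(u) = (u₀∕u₂)·(1 + g(1 − u₁∕u₂))⁻¹` and its properties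
  have hcu : ∀ u ∈ S₁, Valued.v (g * (1 - (u 1 : K) / (u 2 : K))) ≤ Valued.v ϖ ^ ρ ∧ Valued.v (1 + g * (1 - (u 1 : K) / (u 2 : K))) = 1 :=
    fun u hu => v_one_add_mul_one_sub_eq_one hϖ1 hρ s hg ((mem_S₁ u).1 hu).1.2
  have hval : ∀ u ∈ S₁, Valued.v (((u 0 : K) / (u 2 : K)) / (1 + g * (1 - (u 1 : K) / (u 2 : K)))) = 1 := fun u hu => by
    obtain ⟨-, hu1⟩ := (mem_S₁ u).1 hu
    rw [map_div₀, map_div₀, hu1 0, hu1 2, (hcu u hu).2, div_one, div_one]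
  have hne : ∀ u ∈ S₁, ((u 0 : K) / (u 2 : K)) / (1 + g * (1 - (u 1 : K) / (u 2 : K))) ≠ 0 := fun u hu h => by
    have h1 := hval u hu
    rw [h, map_zero] at h1
    exact zero_ne_one h1
  have hc0 : ∀ u ∈ S₁, (1 + g * (1 - (u 1 : K) / (u 2 : K))) ≠ 0 := fun u hu h => by
    have h1 := (hcu u hu).2
    rw [h, map_zero] at h1
    exact zero_ne_one h1
  let θ : S₁ → Kˣ := fun u => Units.mk0 _ (hne u.1 u.2)
  have hθ : ∀ u : S₁, ((θ u : Kˣ) : K) = ((u.1 0 : K) / (u.1 2 : K)) / (1 + g * (1 - (u.1 1 : K) / (u.1 2 : K))) := fun u => rfl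
  -- `θ` is a homomorphism modulo `U_{2ρ}` (the defect lemma)
  have hmul : ∀ u u' : S₁, (QuotientGroup.mk' U2) (θ (u * u')) = (QuotientGroup.mk' U2) (θ u) * (QuotientGroup.mk' U2) (θ u') := by
    intro u u'
    obtain ⟨⟨-, ha⟩, hu1⟩ := (mem_S₁ u.1).1 u.2
    obtain ⟨⟨-, ha'⟩, hu1'⟩ := (mem_S₁ u'.1).1 u'.2
    have hcc := (hcu u.1 u.2).2
    have hcc' := (hcu u'.1 u'.2).2
    have hC := (hcu (u * u').1 (u * u').2).2
    have hC0 := hc0 (u * u').1 (u * u').2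
    rw [← map_mul, QuotientGroup.mk'_apply, QuotientGroup.mk'_apply, QuotientGroup.eq_iff_div_mem, hU2, Units.val_div_eq_div_val, Units.val_mul,
      hθ, hθ, hθ]
    have ea : ((u * u').1 1 : K) / ((u * u').1 2 : K) = (u.1 1 : K) / (u.1 2 : K) * ((u'.1 1 : K) / (u'.1 2 : K)) := by
      simp only [Subgroup.coe_mul, Pi.mul_apply, Units.val_mul]; rw [mul_div_mul_comm]
    have eb : ((u * u').1 0 : K) / ((u * u').1 2 : K) = (u.1 0 : K) / (u.1 2 : K) * ((u'.1 0 : K) / (u'.1 2 : K)) := by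
      simp only [Subgroup.coe_mul, Pi.mul_apply, Units.val_mul]; rw [mul_div_mul_comm]
    rw [ea] at hC hC0
    rw [ea, eb]
    have hb0 : (u.1 0 : K) / (u.1 2 : K) ≠ 0 := div_ne_zero (u.1 0).ne_zero (u.1 2).ne_zero
    have hb0' : (u'.1 0 : K) / (u'.1 2 : K) ≠ 0 := div_ne_zero (u'.1 0).ne_zero (u'.1 2).ne_zero
    have hc1 := hc0 u.1 u.2
    have hc2 := hc0 u'.1 u'.2
    have key : (u.1 0 : K) / (u.1 2 : K) * ((u'.1 0 : K) / (u'.1 2 : K)) / (1 + g * (1 - (u.1 1 : K) / (u.1 2 : K) * ((u'.1 1 : K) / (u'.1 2 : K)))) /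
        ((u.1 0 : K) / (u.1 2 : K) / (1 + g * (1 - (u.1 1 : K) / (u.1 2 : K))) * ((u'.1 0 : K) / (u'.1 2 : K) / (1 + g * (1 - (u'.1 1 : K) / (u'.1 2 : K))))) =
        (1 + g * (1 - (u.1 1 : K) / (u.1 2 : K))) * (1 + g * (1 - (u'.1 1 : K) / (u'.1 2 : K))) / (1 + g * (1 - (u.1 1 : K) / (u.1 2 : K) * ((u'.1 1 : K) / (u'.1 2 : K)))) := by
      field_simp
    rw [key]
    refine ⟨by rw [map_div₀, map_mul, hcc, hcc', hC, one_mul, div_one], ?_⟩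
    rw [div_sub_one hC0, map_div₀, hC, div_one]
    exact v_defect_le hϖ1.le ρ s hg ha ha'
  let Θ : S₁ →* Kˣ ⧸ U2 := MonoidHom.mk' (fun u => (QuotientGroup.mk' U2) (θ u)) hmul
  have hΘ : ∀ u : S₁, Θ u = (QuotientGroup.mk' U2) (θ u) := fun u => rfl
  -- kernel `= S̃`
  have hker : Θ.ker = S.subgroupOf S₁ := by
    ext u
    obtain ⟨⟨ha1, ha⟩, hu1⟩ := (mem_S₁ u.1).1 u.2
    rw [MonoidHom.mem_ker, Subgroup.mem_subgroupOf, hΘ, QuotientGroup.mk'_apply, QuotientGroup.eq_one_iff, hU2, hθ, hS,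
      mem_unitStabilizer_latt_glued_lin_iff hϖ0 hϖ1.le ρ s hx hζ hy'' hg hlin V hV ((mem_unitTorus_iff _).2 hu1)]
    have hb : Valued.v ((u.1 2 : K) - u.1 1) ≤ Valued.v ϖ ^ (ρ + s) := by
      rwa [v_div_sub_one_eq (hu1 2)] at ha
    have h2 : (u.1 2 : K) ≠ 0 := (u.1 2).ne_zero
    have e1 : (u.1 0 : K) / (u.1 2 : K) - (1 + g * (1 - (u.1 1 : K) / (u.1 2 : K))) = -(g * ((u.1 2 : K) - u.1 1) + ((u.1 2 : K) - u.1 0)) / (u.1 2 : K) := by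
      field_simp
      ring
    have hv2 : Valued.v (((u.1 0 : K) / (u.1 2 : K)) / (1 + g * (1 - (u.1 1 : K) / (u.1 2 : K))) - 1) =
        Valued.v (g * ((u.1 2 : K) - u.1 1) + ((u.1 2 : K) - u.1 0)) := by
      rw [div_sub_one (hc0 u.1 u.2), map_div₀, (hcu u.1 u.2).2, div_one, e1, map_div₀, Valuation.map_neg, hu1 2, div_one]
    rw [hv2]
    exact ⟨fun h => ⟨hb, h.2⟩, fun h => ⟨hval u.1 u.2, h.2⟩⟩
  -- image `= 𝒪^× · U_{2ρ} ∕ U_{2ρ}`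
  have hrange : Θ.range = ((unitTorus K 3).map π).map (QuotientGroup.mk' U2) := by
    ext q
    constructor
    · intro hq
      obtain ⟨u, rfl⟩ := MonoidHom.mem_range.1 hq
      refine Subgroup.mem_map.2 ⟨θ u, ?_, (hΘ u).symm⟩
      rw [mem_map_unitTorus_iff π hπ, hθ]
      exact hval u.1 u.2
    · intro hq
      obtain ⟨w, hw, rfl⟩ := Subgroup.mem_map.1 hq
      rw [mem_map_unitTorus_iff π hπ] at hw
      have h10 : (1 : Fin 3) ≠ 0 := by decide
      have h20 : (2 : Fin 3) ≠ 0 := by decide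
      have hu : Pi.mulSingle (0 : Fin 3) w ∈ S₁ := by
        rw [mem_S₁]
        refine ⟨?_, fun i => ?_⟩
        · rw [Pi.mulSingle_eq_of_ne h10, Pi.mulSingle_eq_of_ne h20, Units.val_one, div_one, sub_self, map_one, map_zero]
          exact ⟨rfl, zero_le⟩
        · by_cases hi : i = 0
          · subst hi; rw [Pi.mulSingle_eq_same]; exact hw
          · rw [Pi.mulSingle_eq_of_ne hi, Units.val_one, map_one]
      refine ⟨⟨_, hu⟩, ?_⟩
      rw [hΘ]
      congr 1
      ext
      rw [hθ]
      simp only [Pi.mulSingle_eq_same, Pi.mulSingle_eq_of_ne h10, Pi.mulSingle_eq_of_ne h20, Units.val_one, div_one, sub_self, mul_zero, add_zero]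
  -- count
  have h1 : S.relIndex S₁ = (S.subgroupOf S₁).index := rfl
  rw [h1, ← hker, Subgroup.index_ker, hrange, ← Subgroup.relIndex_ker, QuotientGroup.ker_mk', ← Subgroup.inf_relIndex_right]
  rw [relIndex_unitLevel_eq hϖ (U := (unitTorus K 3).map π) (Un := U2 ⊓ (unitTorus K 3).map π)
    (fun w => mem_map_unitTorus_iff π hπ w) (n := 2 * ρ) (by omega)
    (fun w => by rw [Subgroup.mem_inf, hU2, mem_map_unitTorus_iff π hπ, v_pow_eq_exp_neg hϖ]; tauto)]

/-! ## §3 Heads -/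

/-- **THE GLUED STABILISER INDEX IN THE FULL UNIT TORUS**: for `V = [[1,0,0],[x,ϖ^ρ,0],[xζ+y″, ϖ^ρ ζ, ϖ^{2ρ+s}]]`, `x, ζ` units, `|y″| = |ϖ|^s`, `ρ ≥ 1`:
`[𝒯 : S̃(latt V)] = ((q−1)·q^{ρ+s−1}) · ((q−1)·q^{2ρ−1})` (STEP 1 × STEP 2 with the exact lineariser `g = xζ∕y″`). [cite: Kottwitz1986BaseChangeUnits, §1 pp. 240–241] [cite: Serre1979, Ch. IV §2 Prop. 6] -/
theorem relIndex_latticeStabilizer_latt_glued_eq {ϖ : K} (hϖ : Valued.v ϖ = WithZero.exp (-1 : ℤ)) [Finite 𝓀[K]] {ρ : ℕ} (hρ : 1 ≤ ρ) (s : ℕ) {x ζ y'' : K}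
    (hx : Valued.v x = 1) (hζ : Valued.v ζ = 1) (hy'' : Valued.v y'' = Valued.v ϖ ^ s)
    (V : GL (Fin 3) K) (hV : (V : Matrix (Fin 3) (Fin 3) K) = !![1, 0, 0; x, ϖ ^ ρ, 0; x * ζ + y'', ϖ ^ ρ * ζ, ϖ ^ (2 * ρ + s)]) :
    (latticeStabilizer (latt (V : Matrix (Fin 3) (Fin 3) K))).relIndex (unitTorus K 3) =
      ((Nat.card 𝓀[K] - 1) * Nat.card 𝓀[K] ^ (ρ + s - 1)) * ((Nat.card 𝓀[K] - 1) * Nat.card 𝓀[K] ^ (2 * ρ - 1)) := by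
  obtain ⟨hϖ0, hϖ1⟩ := ne_zero_and_v_lt_one_of_v_eq_exp hϖ
  -- the exact lineariser `g := xζ ∕ y″`
  have hy0 : y'' ≠ 0 := fun h0 => by
    rw [h0, map_zero] at hy''; exact pow_ne_zero _ ((Valuation.ne_zero_iff _).2 hϖ0) hy''.symm
  have hg : Valued.v (x * ζ / y'') * Valued.v ϖ ^ s ≤ 1 := by
    rw [map_div₀, map_mul, hx, hζ, one_mul, hy'', div_mul_cancel₀ _ (pow_ne_zero _ ((Valuation.ne_zero_iff _).2 hϖ0))]
  have hlin : Valued.v (x * ζ - x * ζ / y'' * y'') ≤ Valued.v ϖ ^ ρ := by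
    rw [div_mul_cancel₀ _ hy0, sub_self, map_zero]; exact zero_le
  -- the ratio map and the level group
  let π : (Fin 3 → Kˣ) →* Kˣ := (Pi.evalMonoidHom (fun _ : Fin 3 => Kˣ) 1) / (Pi.evalMonoidHom (fun _ : Fin 3 => Kˣ) 2)
  have hπ : ∀ u, π u = u 1 / u 2 := fun u => rfl
  obtain ⟨Uρs, hU⟩ := exists_unitLevel_subgroup (K := K) (Valued.v ϖ ^ (ρ + s))
  -- two steps
  have hle : latticeStabilizer (latt (V : Matrix (Fin 3) (Fin 3) K)) ⊓ unitTorus K 3 ≤ Uρs.comap π ⊓ unitTorus K 3 := by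
    intro u hu
    rw [Subgroup.mem_inf] at hu ⊢
    refine ⟨?_, hu.2⟩
    have hu1 := (mem_unitTorus_iff u).1 hu.2
    obtain ⟨hb, -⟩ := (mem_unitStabilizer_latt_glued_lin_iff hϖ0 hϖ1.le ρ s hx hζ hy'' hg hlin V hV hu.2).1 hu.1
    rw [Subgroup.mem_comap, hU, hπ, Units.val_div_eq_div_val]
    refine ⟨by rw [map_div₀, hu1 1, hu1 2, div_one], ?_⟩
    rw [v_div_sub_one_eq (hu1 2)]; exact hb
  have hS₁T : Uρs.comap π ⊓ unitTorus K 3 ≤ unitTorus K 3 := inf_le_right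
  have hinf : latticeStabilizer (latt (V : Matrix (Fin 3) (Fin 3) K)) ⊓ (Uρs.comap π ⊓ unitTorus K 3) =
      latticeStabilizer (latt (V : Matrix (Fin 3) (Fin 3) K)) ⊓ unitTorus K 3 :=
    le_antisymm (inf_le_inf_left _ hS₁T) (le_inf inf_le_left hle)
  rw [← Subgroup.inf_relIndex_right (latticeStabilizer _) (unitTorus K 3), ← hinf, ← Subgroup.relIndex_inf_mul_relIndex, inf_of_le_left hS₁T,
    relIndex_latticeStabilizer_ratioLevel_eq hϖ hρ s hx hζ hy'' hg hlin V hV π hπ Uρs hU,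
    relIndex_ratioLevel_unitTorus_eq hϖ (n := ρ + s) (by omega) π hπ Uρs hU, Nat.mul_comm]

/-- **THE ORBIT OF A GLUED LATTICE UNDER THE UNIT TORUS has `((q−1)·q^{ρ+s−1})·((q−1)·q^{2ρ−1})` members** (★ (O1) `ncard_unitTorus_orbit_eq_relIndex` + the index).
[cite: Kottwitz1986BaseChangeUnits, §1 pp. 240–241] -/
theorem ncard_unitTorus_orbit_latt_glued_eq {ϖ : K} (hϖ : Valued.v ϖ = WithZero.exp (-1 : ℤ)) [Finite 𝓀[K]] {ρ : ℕ} (hρ : 1 ≤ ρ) (s : ℕ) {x ζ y'' : K}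
    (hx : Valued.v x = 1) (hζ : Valued.v ζ = 1) (hy'' : Valued.v y'' = Valued.v ϖ ^ s)
    (V : GL (Fin 3) K) (hV : (V : Matrix (Fin 3) (Fin 3) K) = !![1, 0, 0; x, ϖ ^ ρ, 0; x * ζ + y'', ϖ ^ ρ * ζ, ϖ ^ (2 * ρ + s)]) :
    {M : Submodule 𝒪[K] (Fin 3 → K) | ∃ u ∈ unitTorus K 3, M = mapGL (diagGLUnits u) (latt (V : Matrix (Fin 3) (Fin 3) K))}.ncard =
      ((Nat.card 𝓀[K] - 1) * Nat.card 𝓀[K] ^ (ρ + s - 1)) * ((Nat.card 𝓀[K] - 1) * Nat.card 𝓀[K] ^ (2 * ρ - 1)) := by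
  rw [ncard_unitTorus_orbit_eq_relIndex, relIndex_latticeStabilizer_latt_glued_eq hϖ hρ s hx hζ hy'' V hV]

end Summit.HodgeConjecture.HodgeConjecture.Cruxes.H413.F0P3cDyRamDiagonalGluedStabiliserIndexFull

end
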